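import Literature.NumberTheory.Automorphic.LanglandsTunnellModThree
import Literature.NumberTheory.Automorphic.StrongArtinGL2Proofs
import Literature.NumberTheory.Automorphic.PiOfArtinRepFrobSatakeCompatibleProofs
import Literature.NumberTheory.Automorphic.ArthurClozelNilpotentStrongArtin
import Literature.NumberTheory.GaloisRepresentations.SerreOpenImageGroupLemmas
import Literature.NumberTheory.GaloisRepresentations.AbsGaloisGroup
import Literature.NumberTheory.GaloisRepresentations.ProjectiveType
import Mathlib.LinearAlgebra.Projectivization.Action
import Mathlib.LinearAlgebra.Projectivization.Cardinality
import Mathlib.GroupTheory.Nilpotent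
import HarnessLib

/-!
# Stub-ideation k1, GENERATION 6 (HOME FAMILY 1 — recognise & import) for `stub_modThree`

Companion of `STUB-IDEAS-stub_modThree-1.md` (gen 6).  Scope: the ONE non-catalogued input left
open by gens 3–5 of this ideator's line ★N / ★A″ / ★I, namely

  **O1** `O1OctahedralOfSurjective : ∀ ρ̄, Function.Surjective ρ̄ → IsOctahedralType (Ψ ∘ ρ̄)`

("`PGL₂(𝔽₃) ≈ S₄`", Gelbart 1997 §1.4 Step 2; Cornell–Silverman–Stevens p. 218, p. 523), is
REDUCED TO MATHLIB: the projectivization action `Mathlib.LinearAlgebra.Projectivization.Action`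
(`Projectivization.PGL.mk_smul_mk`), `Projectivization.card_of_finrank_two`, the first
isomorphism theorem, and the tree's `GL2F3Lift` (`psi_injective`, `card_GL_fin_two_zmod_three`).
Port template in the tree: `Literature.GroupTheory.SpecificGroups.AltSixPSL.nonempty_mulEquiv_F9`
(`A₆ ≃* PSL₂(𝔽₉)` by a faithful action + an order count) — here no labelling is needed because
`#PGL₂(𝔽₃) = 24 = #Perm(ℙ¹(𝔽₃))`.

STATUS: this file is SORRY-FREE (`lean check` rc 0, 0 sorries, axioms = {propext,
Classical.choice, Quot.sound} for `o1_of_helpers`).  All ten helper lemmas — A1 `psi_neg_one`,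
`mem_center_GL_two_three_iff`, A2 `psi_mem_center_iff`, A3 `ker_mk_comp_psi`, A4
`projectiveImage_modThreeLift_eq_range`, A5 `nonempty_projectiveImage_mulEquiv_PGL`, B1
`toPermHom_PGL_injective` (general `PGL(ι, K)`, Mathlib-PR-shaped), B2 `card_projLine_zmod_three`,
B3 `card_PGL_fin_two_zmod_three`, B4 `nonempty_PGL_mulEquiv_perm_fin_four` — and the composition
`o1_of_helpers : O1OctahedralOfSurjective` are PROVED.  So the input **O1** of the gen-3/4/5 closers
(`…K1G5.stub_modThree_of_nilpotent_octahedral`, `…K1G4.stub_modThree_of_twoSylow_artin'`) is no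
longer open: the residual of ★N is exactly the three catalogued Literature facts
{`ArthurClozel1989_strongArtin_nilpotent`, `strongArtin_of_isOctahedralType`,
`exists_isNewform1_of_isPiOfArtinRep`}.  Nothing is registered; no tree decl is restated except the
gen-3 Prop `O1OctahedralOfSurjective` (verbatim, so `o1_of_helpers` can be fed to the gen-5 closer by
definitional unfolding).  Landable as `--supports stmt-ABC-11340` helper.

PART C/D (so that THIS ONE FILE closes the stub from catalogued facts only): the gen-2 per-`σ`
descent H1 (`isModular_of_langlands_tunnell_at`, the tree proof of
`ModPGaloisRep.isModular_of_isAbsolutelyIrreducible_of_isOdd_of_langlands_tunnell` with its global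
hypothesis localised to `σ = Ψ ∘ ρ̄`), H0, H4 and gen-5's N1–N3 are repeated (all PROVED), and the
★N⁶ closer

  `stub_modThree_of_three_facts :
     ArthurClozel1989_strongArtin_nilpotent → strongArtin_of_isOctahedralType →
     exists_isNewform1_of_isPiOfArtinRep → StubModThree`

is kernel-checked with NO workfile hypothesis left (H1 and O1 discharged here): the stub is now
EXACTLY three catalogued Literature facts away (Arthur–Clozel Ch. 3 Thm. 7.1, Tunnell 1981 — only its
`ℚ`-restriction `StrongArtinOctahedralRat` is used —, Gelbart 1997 Prop. 4.2), versus the eight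
unproved leaves behind the skeleton's pointer `stub_modThree_of_langlands_tunnell`
(`langlands_tunnell_of_leaves'`).
-/

noncomputable section

open scoped MatrixGroups LinearAlgebra.Projectivization NumberField Polynomial
open NumberField IsDedekindDomain Polynomial
open Literature.NumberTheory.EllipticCurves
open Literature.NumberTheory.EllipticCurves.ModularForms
open Literature.NumberTheory.Automorphic
open Literature.NumberTheory.GaloisRepresentations
open Literature.NumberTheory.GaloisRepresentations.GL2F3Lift
open Matrix

set_option linter.dupNamespace false

namespace Summit.ABC.ABC.Cruxes.FreyModularity.Sketch.StubModThreeIdeasK1G6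

/-- gen-3 **O1** as a Prop (verbatim `…K1G5.O1OctahedralOfSurjective`). -/
def O1OctahedralOfSurjective : Prop :=
  ∀ ρ : ModPGaloisRep ℚ (ZMod 3) 2, Function.Surjective ρ →
    IsOctahedralType (modThreeLift ρ).toMonoidHom

/-! ## A — the projective image of `Ψ ∘ ρ̄` is `PGL₂(𝔽₃)` when `ρ̄` is onto -/

/-- **A1** `Ψ(-1) = -1`: `exists_lift_eq_toMat (-1)` puts `Ψ̃(-1)` in `M2.elems`;
`map_redHom_lift` + `eq_of_map_toMat_redHom_eq` against `M2.negOne ∈ M2.elems` (`decide`) give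
`lift (-1) = M2.negOne.toMat = -1`; finish with `val_psi` entrywise.  PROVED. -/
theorem psi_neg_one : psi (-1) = -1 := by
  obtain ⟨x, hx, hgx⟩ := exists_lift_eq_toMat (-1)
  have hneg : M2.negOne ∈ M2.elems := by decide
  have hred : x.toMat.map redHom = M2.negOne.toMat.map redHom := by
    rw [← hgx, map_redHom_lift, map_toMat_redHom]
    ext i j
    fin_cases i <;> fin_cases j <;> simp [M2.negOne, M2.red, Units.val_neg]
  obtain rfl : x = M2.negOne := eq_of_map_toMat_redHom_eq hx hneg hred
  have h1 : (⟨-1, 0⟩ : ℤ√(-2)) = -1 := rfl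
  have h0 : (⟨0, 0⟩ : ℤ√(-2)) = 0 := rfl
  ext i j
  rw [val_psi, hgx]
  fin_cases i <;> fin_cases j <;> simp [M2.toMat, M2.negOne, h1, h0, Units.val_neg]

/-- The centre of `GL₂(𝔽₃)` is `{1, -1}` (Mathlib `center_eq_range_scalar`, `(𝔽₃)ˣ = {±1}`).
PROVED. -/
theorem mem_center_GL_two_three_iff (g : GL (Fin 2) (ZMod 3)) :
    g ∈ Subgroup.center (GL (Fin 2) (ZMod 3)) ↔ g = 1 ∨ g = -1 := by
  rw [Matrix.GeneralLinearGroup.center_eq_range_scalar, MonoidHom.mem_range]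
  constructor
  · rintro ⟨u, rfl⟩
    obtain rfl | rfl : u = 1 ∨ u = -1 := by revert u; decide
    · exact Or.inl (map_one _)
    · right; ext i j; fin_cases i <;> fin_cases j <;> rfl
  · rintro (rfl | rfl)
    · exact ⟨1, map_one _⟩
    · refine ⟨-1, ?_⟩; ext i j; fin_cases i <;> fin_cases j <;> rfl

/-- **A2** `Ψ(g)` is central in `GL₂(ℂ)` iff `g` is central in `GL₂(𝔽₃)` (`⇒`: `Ψ` injective;
`⇐`: A1).  PROVED from A1. -/
theorem psi_mem_center_iff (g : GL (Fin 2) (ZMod 3)) :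
    psi g ∈ Subgroup.center (GL (Fin 2) ℂ) ↔ g ∈ Subgroup.center (GL (Fin 2) (ZMod 3)) := by
  constructor
  · intro hc
    refine Subgroup.mem_center_iff.mpr fun h ↦ psi_injective ?_
    rw [map_mul, map_mul]
    exact Subgroup.mem_center_iff.mp hc (psi h)
  · intro hg
    obtain rfl | rfl := (mem_center_GL_two_three_iff g).mp hg
    · rw [map_one]; exact Subgroup.one_mem _
    · rw [psi_neg_one]
      exact Subgroup.mem_center_iff.mpr fun h ↦ by rw [mul_neg_one, neg_one_mul]

/-- **A3** the kernel of `φ = (GL₂(ℂ) → PGL₂(ℂ)) ∘ Ψ` is the centre of `GL₂(𝔽₃)`.  PROVED. -/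
theorem ker_mk_comp_psi :
    ((Matrix.ProjGenLinGroup.mk (n := Fin 2) (R := ℂ)).comp psi).ker =
      Subgroup.center (GL (Fin 2) (ZMod 3)) := by
  ext g
  rw [MonoidHom.mem_ker, MonoidHom.comp_apply, Matrix.ProjGenLinGroup.mk_eq_one, psi_mem_center_iff]

/-- **A4** for `ρ̄` onto, the projective image of `σ = Ψ ∘ ρ̄` is the range of `φ`.  PROVED. -/
theorem projectiveImage_modThreeLift_eq_range (ρ : ModPGaloisRep ℚ (ZMod 3) 2)
    (hs : Function.Surjective ρ) :
    projectiveImage (modThreeLift ρ).toMonoidHom =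
      ((Matrix.ProjGenLinGroup.mk (n := Fin 2) (R := ℂ)).comp psi).range := by
  ext x
  rw [mem_projectiveImage, MonoidHom.mem_range]
  constructor
  · rintro ⟨γ, rfl⟩
    exact ⟨ρ γ, rfl⟩
  · rintro ⟨g, rfl⟩
    obtain ⟨γ, hγ⟩ := hs g
    exact ⟨γ, by rw [MonoidHom.comp_apply, ← hγ]; rfl⟩

/-- **A5** for `ρ̄` onto, `projectiveImage (Ψ ∘ ρ̄) ≃* PGL₂(𝔽₃)` (first isomorphism theorem; Mathlib's
`PGL(n, R)` is literally `GL n R ⧸ center`).  PROVED from A1 (via A2–A4). -/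
theorem nonempty_projectiveImage_mulEquiv_PGL (ρ : ModPGaloisRep ℚ (ZMod 3) 2)
    (hs : Function.Surjective ρ) :
    Nonempty (projectiveImage (modThreeLift ρ).toMonoidHom ≃* PGL(Fin 2, ZMod 3)) := by
  let φ := (Matrix.ProjGenLinGroup.mk (n := Fin 2) (R := ℂ)).comp psi
  refine ⟨(MulEquiv.subgroupCongr (projectiveImage_modThreeLift_eq_range ρ hs)).trans
    ((QuotientGroup.quotientKerEquivRange φ).symm.trans
      (QuotientGroup.quotientMulEquivOfEq ker_mk_comp_psi))⟩

/-! ## B — `PGL₂(𝔽₃) ≃* S₄` through the faithful action on the four points of `ℙ¹(𝔽₃)` -/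

/-- **B1** `PGL_n(K)` acts faithfully on `ℙ(Kⁿ)` (any field `K`, any non-empty finite `ι`) — the
`GL` twin of Mathlib's `Projectivization.SL_mulAction_ker` /
`Matrix.ProjectiveSpecialLinearGroup.toPermHom_injective` (absent from Mathlib for `PGL`; a
Mathlib-PR-shaped lemma).  Proof ported from `SL_mulAction_ker`: `PGL.mk_smul_mk` +
`mk_eq_mk_iff'` give `g v ∥ v` for all `v ≠ 0`, `LinearMap.exists_eq_smul_id_of_forall_notLinearIndependent`
makes `g = scalar a`, `a ≠ 0` by `det`, and `center_eq_range_scalar`.  PROVED. -/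
theorem toPermHom_PGL_injective {K : Type*} [Field K] {ι : Type*} [Fintype ι] [DecidableEq ι]
    [Nonempty ι] :
    Function.Injective (MulAction.toPermHom PGL(ι, K) (ℙ K (ι → K))) := by
  rw [injective_iff_map_eq_one]
  intro h hh
  obtain ⟨g, rfl⟩ := Matrix.ProjGenLinGroup.mk_surjective h
  rw [Matrix.ProjGenLinGroup.mk_eq_one, Matrix.GeneralLinearGroup.center_eq_range_scalar]
  have hfix : ∀ (v : ι → K) (hv : v ≠ 0), ∃ a : K, a • v = (g : Matrix ι ι K) *ᵥ v := by
    intro v hv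
    have := Equiv.ext_iff.mp hh (Projectivization.mk K v hv)
    rw [MulAction.toPermHom_apply, MulAction.toPerm_apply, Equiv.Perm.one_apply,
      Projectivization.PGL.mk_smul_mk, Projectivization.mk_eq_mk_iff'] at this
    exact this
  set f : (ι → K) →ₗ[K] ι → K := Matrix.toLin' (g : Matrix ι ι K) with hf
  obtain ⟨a, ha⟩ := f.exists_eq_smul_id_of_forall_notLinearIndependent fun v ↦ by
    by_cases hv : v = 0
    · simp [hv, linearIndependent_fin2]
    · rw [LinearIndependent.pair_iff' hv, not_forall]
      obtain ⟨a, ha⟩ := hfix v hv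
      exact ⟨a, by simpa [hf] using ha⟩
  have hscalar : (g : Matrix ι ι K) = Matrix.scalar ι a := calc
    (g : Matrix ι ι K) = LinearMap.toMatrix' f := by rw [hf, LinearMap.toMatrix'_toLin']
    _ = (algebraMap K (Module.End K (ι → K)) a).toMatrix' := congrArg LinearMap.toMatrix' ha
    _ = Matrix.scalar ι a := LinearMap.toMatrix'_algebraMap a
  have ha0 : a ≠ 0 := by
    rintro rfl
    have hdet := g.isUnit.map Matrix.detMonoidHom
    rw [Matrix.coe_detMonoidHom, hscalar, Matrix.scalar_apply, Matrix.det_diagonal,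
      Finset.prod_const, Finset.card_univ, zero_pow Fintype.card_ne_zero] at hdet
    exact not_isUnit_zero hdet
  refine ⟨Units.mk0 a ha0, ?_⟩
  ext i j
  rw [Matrix.GeneralLinearGroup.coe_scalar, hscalar, Units.val_mk0]

/-- **B2** `#ℙ¹(𝔽₃) = 3 + 1 = 4` (Mathlib `Projectivization.card_of_finrank_two`).  PROVED. -/
theorem card_projLine_zmod_three : Nat.card (ℙ (ZMod 3) (Fin 2 → ZMod 3)) = 4 := by
  rw [Projectivization.card_of_finrank_two (ZMod 3) (Fin 2 → ZMod 3) (Module.finrank_fin_fun _),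
    Nat.card_zmod]

/-- **B3** `#PGL₂(𝔽₃) = 48 / 2 = 24`: `PGL(n, R)` is `GL n R ⧸ center` by definition,
`Subgroup.card_eq_card_quotient_mul_card_subgroup`, the tree's `GL2F3Lift.card_GL_fin_two_zmod_three`
(`= 48`) and `Nat.card (center GL₂(𝔽₃)) = 2` (`mem_center_GL_two_three_iff`, `Nat.card_eq_two_iff`).
PROVED. -/
theorem card_PGL_fin_two_zmod_three : Nat.card PGL(Fin 2, ZMod 3) = 24 := by
  have hne : (1 : GL (Fin 2) (ZMod 3)) ≠ -1 := by
    intro h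
    have hval : ((1 : GL (Fin 2) (ZMod 3)) : Matrix (Fin 2) (Fin 2) (ZMod 3)) =
        ((-1 : GL (Fin 2) (ZMod 3)) : Matrix (Fin 2) (Fin 2) (ZMod 3)) := congrArg Units.val h
    have h00 := congr_fun (congr_fun hval 0) 0
    simp [Units.val_neg] at h00
    exact absurd h00 (by decide)
  have hc : Nat.card (Subgroup.center (GL (Fin 2) (ZMod 3))) = 2 := by
    rw [Nat.card_eq_two_iff]
    refine ⟨⟨1, Subgroup.one_mem _⟩, ⟨-1, (mem_center_GL_two_three_iff _).mpr (Or.inr rfl)⟩,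
      fun h ↦ hne (congrArg Subtype.val h), ?_⟩
    rw [Set.eq_univ_iff_forall]
    rintro ⟨g, hg⟩
    rcases (mem_center_GL_two_three_iff g).mp hg with rfl | rfl
    · exact Set.mem_insert _ _
    · exact Set.mem_insert_of_mem _ rfl
  have h := Subgroup.card_eq_card_quotient_mul_card_subgroup
    (Subgroup.center (GL (Fin 2) (ZMod 3)))
  rw [card_GL_fin_two_zmod_three, hc] at h
  change Nat.card (GL (Fin 2) (ZMod 3) ⧸ Subgroup.center (GL (Fin 2) (ZMod 3))) = 24
  omega

/-- **B4** `PGL₂(𝔽₃) ≃* S₄ = Perm (Fin 4)`: the faithful action on `ℙ¹(𝔽₃)` (B1) is a monomorphism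
`PGL₂(𝔽₃) ↪ Perm(ℙ¹(𝔽₃)) ≃ Perm (Fin 4)` between groups of order `24` (B2, B3).  PROVED from B1, B3. -/
theorem nonempty_PGL_mulEquiv_perm_fin_four :
    Nonempty (PGL(Fin 2, ZMod 3) ≃* Equiv.Perm (Fin 4)) := by
  let e : ℙ (ZMod 3) (Fin 2 → ZMod 3) ≃ Fin 4 := Finite.equivFinOfCardEq card_projLine_zmod_three
  let θ : PGL(Fin 2, ZMod 3) →* Equiv.Perm (Fin 4) :=
    e.permCongrHom.toMonoidHom.comp (MulAction.toPermHom PGL(Fin 2, ZMod 3) (ℙ (ZMod 3) (Fin 2 → ZMod 3)))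
  have hθ : Function.Injective θ := e.permCongrHom.injective.comp toPermHom_PGL_injective
  refine ⟨MulEquiv.ofBijective θ (hθ.bijective_of_nat_card_le ?_)⟩
  rw [card_PGL_fin_two_zmod_three, Nat.card_eq_fintype_card, Fintype.card_perm, Fintype.card_fin]
  decide

/-! ## The composition: O1 -/

/-- **O1, PROVED (sorry-free)**: for `ρ̄` onto `GL₂(𝔽₃)`,
`projectiveImage (Ψ ∘ ρ̄) ≃* PGL₂(𝔽₃) ≃* S₄`, i.e. `Ψ ∘ ρ̄` is of octahedral type
(Gelbart 1997 §1.4 Step 2; Cornell–Silverman–Stevens pp. 218, 523). -/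
theorem o1_of_helpers : O1OctahedralOfSurjective := fun ρ hs ↦
  let ⟨e₁⟩ := nonempty_projectiveImage_mulEquiv_PGL ρ hs
  let ⟨e₂⟩ := nonempty_PGL_mulEquiv_perm_fin_four
  ⟨e₁.trans e₂⟩


/-! ## C — carried chain (gen 2: H0, H1, H4; gen 5: N1–N3), all PROVED, repeated so that this file
alone closes the stub; H1 is the tree's descent proof with its hypothesis localised to one `σ` -/


/-- The registered stub statement, verbatim. -/
def StubModThree : Prop :=
  ∀ (W : WeierstrassCurve ℚ) [W.IsElliptic] (ρ : ModPGaloisRep ℚ (ZMod 3) 2),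
    W.IsTorsionGaloisRep 3 ρ → FramedRep.IsAbsolutelyIrreducible ρ → ρ.IsModular

/-- **H1 (per-`σ` Langlands–Tunnell descent), PROVED**: the tree's
`ModPGaloisRep.isModular_of_isAbsolutelyIrreducible_of_isOdd_of_langlands_tunnell` uses its global
hypothesis `∀ σ, langlands_tunnell σ` only at `σ = Ψ ∘ ρ̄`; this is that proof verbatim with the
hypothesis localised (gen 2 `…K1G2.isModular_of_langlands_tunnell_at`). -/
theorem isModular_of_langlands_tunnell_at (ρ : ModPGaloisRep ℚ (ZMod 3) 2)
    (hLT : langlands_tunnell (modThreeLift ρ))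
    (habs : FramedRep.IsAbsolutelyIrreducible ρ) (hodd : FramedGaloisRep.IsOdd ρ) : ρ.IsModular := by
  classical
  set σ : FramedArtinRep ℚ 2 := modThreeLift ρ with hσ
  have hirrσ : σ.toGaloisRep.IsIrreducible :=
    (FramedRep.isIrreducible_toContinuousRep_iff σ).mpr (isIrreducible_modThreeLift habs)
  have hoddσ : σ.IsOdd := isOdd_modThreeLift hodd
  have hsolv : IsSolvable (MonoidHom.range σ.toMonoidHom) := isSolvable_range_modThreeLift ρ
  obtain ⟨N, hN, f, hnew, hgal⟩ := hLT hirrσ hoddσ hsolv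
  obtain ⟨𝔓, h𝔓max, h𝔓⟩ := exists_ideal_over_ker_redHom
  haveI : 𝔓.IsMaximal := h𝔓max
  letI : Field (integralClosure ℤ ℂ ⧸ 𝔓) := Ideal.Quotient.field 𝔓
  letI : TopologicalSpace (integralClosure ℤ ℂ ⧸ 𝔓) := ⊥
  haveI : DiscreteTopology (integralClosure ℤ ℂ ⧸ 𝔓) := ⟨rfl⟩
  have hle : RingHom.ker redHom ≤ 𝔓.comap embInt := h𝔓.ge
  let j : ZMod 3 →+* integralClosure ℤ ℂ ⧸ 𝔓 :=
    (Ideal.quotientMap 𝔓 embInt hle).comp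
      (RingHom.quotientKerEquivOfSurjective redHom_surjective).symm.toRingHom
  have hj : ∀ t : ℤ√(-2), j (redHom t) = Ideal.Quotient.mk 𝔓 (embInt t) := by
    intro t
    simp only [j, RingHom.coe_comp, Function.comp_apply, RingEquiv.toRingHom_eq_coe,
      RingEquiv.coe_toRingHom, RingHom.quotientKerEquivOfSurjective_symm_apply,
      Ideal.quotientMap_mk]
  have hjred : j.comp redHom = (Ideal.Quotient.mk 𝔓).comp embInt := RingHom.ext hj
  let θ : coeffCharIntegers f →+* integralClosure ℤ ℂ :=
    ((algebraMap (coeffCharField f) ℂ).comp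
        (algebraMap (coeffCharIntegers f) (coeffCharField f))).codRestrict (integralClosure ℤ ℂ)
      fun x ↦ (x.2 : IsIntegral ℤ (x : coeffCharField f)).map
        (algebraMap (coeffCharField f) ℂ).toIntAlgHom
  let ι : coeffCharIntegers f →+* integralClosure ℤ ℂ ⧸ 𝔓 := (Ideal.Quotient.mk 𝔓).comp θ
  refine ⟨N, hN, 1, f, integralClosure ℤ ℂ ⧸ 𝔓, inferInstance, inferInstance, inferInstance, j, ι,
    le_refl _, hnew, ?_⟩
  intro v hv
  have hpN : ((Rat.HeightOneSpectrum.primesEquiv v : Nat.Primes) : ℕ) ∉ {q : ℕ | q ∣ N} :=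
    fun h ↦ hv (dvd_mul_of_dvd_left h _)
  obtain ⟨hunr, hfrob⟩ := hgal v hpN
  refine ⟨?_, ?_⟩
  · intro 𝔔 h𝔔 τ hτ
    have h1 : psi (ρ τ) = 1 := hunr 𝔔 h𝔔 τ hτ
    have h2 : ρ τ = 1 := psi_injective (by rw [map_one]; exact h1)
    rw [FramedRep.baseChange_apply, h2, map_one]
  · set hecke := heckePolynomial f (Rat.HeightOneSpectrum.primesEquiv v : Nat.Primes) with hhecke
    have key : ∀ (𝔔 : Ideal (absIntegers (𝓞 ℚ) ℚ)) (_ : 𝔔 ∈ v.primesAbove)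
        (τ : Field.absoluteGaloisGroup ℚ), IsArithFrobAt (𝓞 ℚ) τ 𝔔 →
        hecke.map (algebraMap (coeffCharField f) ℂ) = ((lift (ρ τ)).charpoly).map embHom := by
      intro 𝔔 h𝔔 τ hτ
      rw [← charpoly_psi, ← hfrob 𝔔 h𝔔 τ hτ]
      rfl
    obtain ⟨𝔔₀, h𝔔₀⟩ := HeightOneSpectrum.primesAbove_nonempty v
    obtain ⟨τ₀, hτ₀⟩ := HeightOneSpectrum.exists_isArithFrobAt_of_mem_primesAbove_holds h𝔔₀
    have hinj : Function.Injective (algebraMap (coeffCharField f) ℂ).toIntAlgHom :=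
      (algebraMap (coeffCharField f) ℂ).injective
    have hint : ∀ n : ℕ, hecke.coeff n ∈ coeffCharIntegers f := by
      intro n
      have h1 : IsIntegral ℤ (algebraMap (coeffCharField f) ℂ (hecke.coeff n)) := by
        rw [← Polynomial.coeff_map, key 𝔔₀ h𝔔₀ τ₀ hτ₀, Polynomial.coeff_map]
        exact isIntegral_embHom _
      change IsIntegral ℤ (hecke.coeff n)
      exact (isIntegral_algHom_iff (algebraMap (coeffCharField f) ℂ).toIntAlgHom hinj).mp h1
    have hlifts : hecke ∈ Polynomial.lifts (algebraMap (coeffCharIntegers f) (coeffCharField f)) := by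
      rw [Polynomial.lifts_iff_coeff_lifts]
      intro n
      exact ⟨⟨hecke.coeff n, hint n⟩, rfl⟩
    obtain ⟨P, hP⟩ := (Polynomial.mem_lifts _).mp hlifts
    refine ⟨P, hP, ?_⟩
    intro 𝔔 h𝔔 τ hτ
    have hPθ : P.map θ = ((lift (ρ τ)).charpoly).map embInt := by
      apply Polynomial.map_injective (integralClosure ℤ ℂ).val.toRingHom Subtype.val_injective
      rw [Polynomial.map_map, Polynomial.map_map]
      have e1 : (integralClosure ℤ ℂ).val.toRingHom.comp θ =
          (algebraMap (coeffCharField f) ℂ).comp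
            (algebraMap (coeffCharIntegers f) (coeffCharField f)) :=
        RingHom.ext fun _ ↦ rfl
      have e2 : (integralClosure ℤ ℂ).val.toRingHom.comp embInt = embHom := RingHom.ext fun _ ↦ rfl
      rw [e1, e2, ← Polynomial.map_map, hP, key 𝔔 h𝔔 τ hτ]
    calc FramedRep.charpoly (FramedRep.baseChange j continuous_of_discreteTopology ρ) τ
        = ((((ρ τ : GL (Fin 2) (ZMod 3)) : Matrix (Fin 2) (Fin 2) (ZMod 3))).map j).charpoly := rfl
      _ = (((ρ τ : GL (Fin 2) (ZMod 3)) : Matrix (Fin 2) (Fin 2) (ZMod 3))).charpoly.map j :=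
          Matrix.charpoly_map _ _
      _ = (((lift (ρ τ)).charpoly).map redHom).map j := by rw [map_redHom_charpoly_lift]
      _ = ((lift (ρ τ)).charpoly).map ((Ideal.Quotient.mk 𝔓).comp embInt) := by
          rw [Polynomial.map_map, hjred]
      _ = (P.map θ).map (Ideal.Quotient.mk 𝔓) := by rw [hPθ, Polynomial.map_map]
      _ = P.map ι := by rw [Polynomial.map_map]

/-- gen-2 **H0** (PROVED): `ρ̄_{E,3}` is odd (`det ρ̄ = χ₃`). -/
theorem isOdd_of_isTorsionGaloisRep_three (W : WeierstrassCurve ℚ) [W.IsElliptic]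
    (ρ : ModPGaloisRep ℚ (ZMod 3) 2) (hρ : W.IsTorsionGaloisRep 3 ρ) :
    FramedGaloisRep.IsOdd ρ := by
  haveI : NeZero ((3 : ℕ) : ℚ) := ⟨by norm_num⟩
  intro φ c hc
  rw [W.det_eq_modPCyclotomicCharacter_of_isTorsionGaloisRep_holds 3 ρ hρ c]
  ext
  rw [modPCyclotomicCharacterZMod_eq_modNCyclotomicCharacter,
    modNCyclotomicCharacter_of_isComplexConjugation hc, Units.val_neg, Units.val_one]

/-- gen-2 **H4** (PROVED): Langlands–Tunnell for ONE `σ` from `π(σ)` and Gelbart Prop. 4.2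
(`exists_isNewform1_of_isPiOfArtinRep`); Prop. 4.1 is the tree THEOREM
`frobSatakeCompatibleAt_of_isPiOfArtinRep_holds`. -/
theorem langlands_tunnell_of_exists_isPiOfArtinRep (hW1 : exists_isNewform1_of_isPiOfArtinRep)
    (σ : FramedArtinRep ℚ 2)
    (hπ : σ.toGaloisRep.IsIrreducible →
      ∃ (hcpt : isCompact_glFiniteIntegralLevel 2 ℚ) (π : CuspidalAutomorphicRepData 2 ℚ hcpt),
        IsPiOfArtinRep σ π.1) :
    langlands_tunnell σ := by
  intro hirr hodd _hsolv
  obtain ⟨hcpt, π, hπ⟩ := hπ hirr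
  obtain ⟨N, hN, f, hf, -, hsat⟩ := hW1 hcpt σ π hirr hodd hπ
  refine ⟨N, hN, f, hf, fun v hv => ?_⟩
  obtain ⟨α, hα, hpoly⟩ := hsat v hv
  obtain ⟨hur, hchar⟩ := frobSatakeCompatibleAt_of_isPiOfArtinRep_holds hcpt σ π hπ v α hα
  exact ⟨hur, hpoly ▸ hchar⟩

/-- **N1a** (PROVED): an odd `ρ̄ : Γ_ℚ → GL₂(𝔽₃)` has `det` ONTO `𝔽₃ˣ = {±1}` on its image. -/
theorem det_surjOn_range_of_isOdd (ρ : ModPGaloisRep ℚ (ZMod 3) 2) (hodd : FramedGaloisRep.IsOdd ρ) :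
    ∀ u : (ZMod 3)ˣ, ∃ g ∈ ρ.toMonoidHom.range, Matrix.GeneralLinearGroup.det g = u := by
  obtain ⟨c, hc⟩ := exists_isComplexConjugation (Rat.castHom ℝ)
  have hc' : Matrix.GeneralLinearGroup.det (ρ c) = -1 := hodd (Rat.castHom ℝ) c hc
  intro u
  obtain rfl | rfl : u = 1 ∨ u = -1 := by revert u; decide
  · exact ⟨1, one_mem _, map_one _⟩
  · exact ⟨ρ c, ⟨c, rfl⟩, hc'⟩

/-- **N1b** (PROVED): an irreducible `ρ̄` has image in NO Borel subgroup. -/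
theorem not_range_le_eigenvectorStabilizer (ρ : ModPGaloisRep ℚ (ZMod 3) 2)
    (hirr : FramedRep.IsIrreducible ρ) (v : Fin 2 → ZMod 3) (hv : v ≠ 0) :
    ¬ ρ.toMonoidHom.range ≤ eigenvectorStabilizer v hv := by
  intro hle
  have key : ∀ g : Field.absoluteGaloisGroup ℚ, ∃ a : ZMod 3,
      ((ρ g : GL (Fin 2) (ZMod 3)) : Matrix (Fin 2) (Fin 2) (ZMod 3)) *ᵥ v = a • v :=
    fun g ↦ mem_eigenvectorStabilizer_iff.mp (hle ⟨g, rfl⟩)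
  have hirr' : IsSimpleOrder (Subrepresentation (FramedRep.toRepresentation ρ)) := hirr
  let S : Subrepresentation (FramedRep.toRepresentation ρ) :=
    { toSubmodule := (ZMod 3) ∙ v
      apply_mem_toSubmodule := by
        intro g w hw
        obtain ⟨b, rfl⟩ := Submodule.mem_span_singleton.mp hw
        obtain ⟨a, ha⟩ := key g
        rw [FramedRep.toRepresentation_apply_apply, Matrix.mulVec_smul, ha, smul_smul]
        exact Submodule.mem_span_singleton.mpr ⟨b * a, rfl⟩ }
  rcases hirr'.eq_bot_or_eq_top S with hS | hS
  · have hvS : v ∈ S := Submodule.mem_span_singleton_self v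
    rw [hS] at hvS
    exact hv ((Submodule.mem_bot (ZMod 3)).mp hvS)
  · have h1 : Module.finrank (ZMod 3) ((ZMod 3) ∙ v) = 1 := finrank_span_singleton hv
    have h2 : ((ZMod 3) ∙ v : Submodule (ZMod 3) (Fin 2 → ZMod 3)) = ⊤ :=
      congrArg Subrepresentation.toSubmodule hS
    rw [h2, finrank_top, Module.finrank_fin_fun] at h1
    exact absurd h1 (by norm_num)

/-- **N1** (PROVED): `ρ̄` irreducible and odd ⇒ `ρ̄` surjective or its image is a `2`-group. -/
theorem surjective_or_isPGroup_two (ρ : ModPGaloisRep ℚ (ZMod 3) 2)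
    (hirr : FramedRep.IsIrreducible ρ) (hodd : FramedGaloisRep.IsOdd ρ) :
    Function.Surjective ρ ∨ IsPGroup 2 ρ.toMonoidHom.range := by
  classical
  haveI : Fact (Nat.Prime 3) := ⟨Nat.prime_three⟩
  set G := ρ.toMonoidHom.range with hG
  by_cases hs : Function.Surjective ρ
  · exact Or.inl hs
  refine Or.inr ?_
  have h3 : ¬ 3 ∣ Nat.card G := by
    intro h
    rcases Serre1972.eq_top_or_borel_of_dvd_card G h (det_surjOn_range_of_isOdd ρ hodd) with
      htop | ⟨v, hv, hle⟩
    · exact hs (MonoidHom.range_eq_top.mp htop)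
    · exact not_range_le_eigenvectorStabilizer ρ hirr v hv hle
  have h48 : Nat.card G ∣ 2 ^ 4 * 3 := by
    have h := Subgroup.card_subgroup_dvd_card G
    rwa [card_GL_fin_two_zmod_three] at h
  have h16 : Nat.card G ∣ 2 ^ 4 :=
    Nat.Coprime.dvd_of_dvd_mul_right ((Nat.Prime.coprime_iff_not_dvd Nat.prime_three).mpr h3).symm h48
  obtain ⟨k, -, hk⟩ := (Nat.dvd_prime_pow Nat.prime_two).1 h16
  exact IsPGroup.of_card hk

/-- **N2** (PROVED): a `2`-group image lifts to a nilpotent image of `σ = Ψ ∘ ρ̄`. -/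
theorem isNilpotent_range_modThreeLift_of_isPGroup (ρ : ModPGaloisRep ℚ (ZMod 3) 2)
    (h : IsPGroup 2 ρ.toMonoidHom.range) :
    Group.IsNilpotent (modThreeLift ρ).toMonoidHom.range := by
  haveI : Fact (Nat.Prime 2) := ⟨Nat.prime_two⟩
  haveI : Finite (modThreeLift ρ).toMonoidHom.range := finite_range_toMonoidHom (modThreeLift ρ)
  have hr : (modThreeLift ρ).toMonoidHom.range = (ρ.toMonoidHom.range).map psi := by
    rw [← MonoidHom.range_comp]; rfl
  have hP : IsPGroup 2 (modThreeLift ρ).toMonoidHom.range := by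
    rw [hr]; exact h.map psi
  exact hP.isNilpotent

/-- **N3** (PROVED from the catalogued fact): the 2-group branch is Arthur–Clozel Ch. 3 Thm. 7.1. -/
theorem exists_isPiOfArtinRep_of_isPGroup_two (hAC : ArthurClozel1989_strongArtin_nilpotent)
    (ρ : ModPGaloisRep ℚ (ZMod 3) 2) (h2 : IsPGroup 2 ρ.toMonoidHom.range)
    (hirr : (modThreeLift ρ).toGaloisRep.IsIrreducible) :
    ∃ (hcpt : isCompact_glFiniteIntegralLevel 2 ℚ) (π : CuspidalAutomorphicRepData 2 ℚ hcpt),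
      IsPiOfArtinRep (modThreeLift ρ) π.1 :=
  hAC (modThreeLift ρ) two_pos hirr (isNilpotent_range_modThreeLift_of_isPGroup ρ h2)


/-! ## D — the ★N⁶ closers: `stub_modThree` from three catalogued facts, O1 and H1 discharged -/

/-- gen-4 **Tunnell 1981 over `ℚ`** (the catalogued `strongArtin_of_isOctahedralType` restricted to `ℚ`;
verbatim `…K1G5.StrongArtinOctahedralRat`). -/
def StrongArtinOctahedralRat : Prop :=
  ∀ σ : FramedArtinRep ℚ 2, σ.toGaloisRep.IsIrreducible → IsOctahedralType σ.toMonoidHom →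
    ∃ (hcpt : isCompact_glFiniteIntegralLevel 2 ℚ) (π : CuspidalAutomorphicRepData 2 ℚ hcpt),
      IsPiOfArtinRep σ π.1

/-- The catalogued fact implies its `ℚ`-restriction (bookkeeping, PROVED). -/
theorem strongArtinOctahedralRat_of_fact (ho : strongArtin_of_isOctahedralType) :
    StrongArtinOctahedralRat :=
  fun σ hirr hO => ho σ hirr hO

/-- **Langlands–Tunnell at `σ = Ψ ∘ ρ̄` from {AC Thm. 7.1, Tunnell/ℚ, Gelbart 4.2}, O1 DISCHARGED**
(PROVED): surjective `ρ̄` ⇒ octahedral `σ` (`o1_of_helpers`) ⇒ Tunnell; else the image of `ρ̄` is a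
`2`-group (N1) ⇒ `σ` has nilpotent image (N2) ⇒ Arthur–Clozel (N3).  Langlands' tetrahedral theorem
and the dihedral/JL leaf are never invoked. -/
theorem langlands_tunnell_modThreeLift (hAC : ArthurClozel1989_strongArtin_nilpotent)
    (ho : StrongArtinOctahedralRat) (hW1 : exists_isNewform1_of_isPiOfArtinRep)
    (ρ : ModPGaloisRep ℚ (ZMod 3) 2) (hirr : FramedRep.IsIrreducible ρ)
    (hodd : FramedGaloisRep.IsOdd ρ) : langlands_tunnell (modThreeLift ρ) :=
  langlands_tunnell_of_exists_isPiOfArtinRep hW1 (modThreeLift ρ) fun hirr' ↦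
    (surjective_or_isPGroup_two ρ hirr hodd).elim
      (fun hs ↦ ho (modThreeLift ρ) hirr' (o1_of_helpers ρ hs))
      (fun h2 ↦ exists_isPiOfArtinRep_of_isPGroup_two hAC ρ h2 hirr')

/-- ★N⁶ **closer, ℚ-restricted octahedral input** (kernel-checked, no workfile hypothesis):
`stub_modThree` from {`ArthurClozel1989_strongArtin_nilpotent`, `StrongArtinOctahedralRat`,
`exists_isNewform1_of_isPiOfArtinRep`}. -/
theorem stub_modThree_of_three_facts_rat (hAC : ArthurClozel1989_strongArtin_nilpotent)
    (ho : StrongArtinOctahedralRat) (hW1 : exists_isNewform1_of_isPiOfArtinRep) : StubModThree := by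
  intro W _ ρ hρ habs
  have hodd := isOdd_of_isTorsionGaloisRep_three W ρ hρ
  exact isModular_of_langlands_tunnell_at ρ
    (langlands_tunnell_modThreeLift hAC ho hW1 ρ habs.isIrreducible hodd) habs hodd

/-- ★N⁶ **THE closer** (kernel-checked, no workfile hypothesis): `stub_modThree` from the three
CATALOGUED tree facts `ArthurClozel1989_strongArtin_nilpotent` (Arthur–Clozel 1989 Ch. 3 Thm. 7.1),
`strongArtin_of_isOctahedralType` (Tunnell 1981) and `exists_isNewform1_of_isPiOfArtinRep`
(Gelbart 1997 Prop. 4.2). -/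
theorem stub_modThree_of_three_facts (hAC : ArthurClozel1989_strongArtin_nilpotent)
    (ho : strongArtin_of_isOctahedralType) (hW1 : exists_isNewform1_of_isPiOfArtinRep) :
    StubModThree :=
  stub_modThree_of_three_facts_rat hAC (strongArtinOctahedralRat_of_fact ho) hW1

end Summit.ABC.ABC.Cruxes.FreyModularity.Sketch.StubModThreeIdeasK1G6

end
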